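import Summits.QuantumFields.YangMills.Theorems.IR.VacuumEscapeCheeger
import Summits.QuantumFields.YangMills.Theorems.IR.VacuumEscapeRungStrongCoupling
import HarnessLib

/-!
# Crux `IR` (stmt-QuantumFields-19354), line `vacuum_escape`: the strong-coupling RUNG in the slice-chain currency PROVED —
`sliceConductanceStrongCoupling_holds : ∀ G r, SliceConductanceStrongCoupling G r`

Helper module for item `stmt-QuantumFields-19354` (`--supports … --as helper`).  `SliceConductanceStrongCoupling` is the tree constant of
`Theorems/IR/VacuumEscapeDefs.lean` (p590997) and the statement of the registered rung stub `VacuumEscape.stub_rungStrongCoupling` of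
skeleton v5 `Cruxes/IR/Lines/vacuum_escape.lean`, which therefore closes by `exact sliceConductanceStrongCoupling_holds`:
ONE `c > 0` and `β₀ > 0` such that for `0 ≤ β ≤ β₀`, EVERY spatial torus `(2S+1)³` and every measurable slice event `A`,
`c · mass_m(A) (1 − mass_m(A)) ≤ mass_m(A) − stay_m(A)` for all large temporal extents `m + 2`.

**Proof.**  `c = (1 − e^{−1/4})/2`, `β₀ = strongCouplingRadius r.ρ`.  Per `(β, S, A)`:
(1) the slice-chain probabilities converge, `mass_m(A) → P = ∫_A h²`, `stay_m(A) → Q = λ₀⁻¹ ∫_A∫_A h K_β h` (`h` the Perron ground state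
of Lüscher's transfer matrix; spectral sums of `VacuumEscapeCheegerSpectral`, exactly as in `traceExcess_le_of_sliceConductance`);
(2) the vacuum conductance `(1 − e^{−1/4}) P (1 − P) ≤ P − Q` (variational Parseval bound `setIntegral_kernel_le_of_gap` in the tree's
volume-uniform strong-coupling eigenbasis `transferGap_of_strongCoupling`, whose top vector is `±h` by simplicity of the top eigenvalue);
(3) if `0 < P < 1` the limit inequality is STRICT for `c = (1 − e^{−1/4})/2`, hence holds eventually in `m`; if `P ∈ {0, 1}` then `A`
(resp. `Aᶜ`) is Haar-null (`h ≥ h₀ > 0`), so `mass_m(A) = stay_m(A) ∈ {0, 1}` exactly and both sides vanish.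

HONEST FRAMING: a FORMAT rung inside the known strong-coupling regime of ONE line of the OPEN gap-crux `IR`; nothing here bears on weak
coupling; the YM mass gap (Clay) is NOT proved; `R4` closes only the conditional rung `BalabanLadder.UV`.
Refs: K. Osterwalder, E. Seiler, Ann. Phys. 110 (1978) 440 §3; G. F. Lawler, A. D. Sokal, Trans. AMS 309 (1988) 557 (2.18); tree files above.
-/

set_option autoImplicit false

noncomputable section

open MeasureTheory Filter Set Function
open scoped RealInnerProductSpace ENNReal Topology
open Literature.Analysis.OperatorTheory Literature.MathematicalPhysics.QuantumFieldTheory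
open Literature.MathematicalPhysics.QuantumFieldTheory.Balaban1983to89.Missing (strongCouplingRadius strongCouplingRadius_pos
  transferGap_of_strongCoupling cyclicPartition_pos_of_unitary)
open Summit.QuantumFields.YangMills.Cruxes.IR.VacuumEscape.Spectral Summit.QuantumFields.YangMills.Cruxes.IR.VacuumEscape.GroundState

namespace Summit.QuantumFields.YangMills.Cruxes.IR.VacuumEscape

section PerTorus

variable {G : Type} [Group G] [TopologicalSpace G] [IsTopologicalGroup G] [CompactSpace G] [MeasurableSpace G] [BorelSpace G]
  [SecondCountableTopology G] {n : ℕ} {ρ : G →* Matrix (Fin n) (Fin n) ℂ}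

omit [IsTopologicalGroup G] [CompactSpace G] [MeasurableSpace G] [BorelSpace G] [SecondCountableTopology G] in
/-- Strict margin (kept out of the large proof context): `c₀ t ≤ R`, `0 < c₀`, `0 < t` give `(c₀/2) t < R`. -/
theorem half_mul_lt_of_le {c₀ t R : ℝ} (hc : 0 < c₀) (ht : 0 < t) (h : c₀ * t ≤ R) : c₀ / 2 * t < R := by
  nlinarith [mul_pos hc ht]

omit [SecondCountableTopology G] in
/-- A cyclic expectation of an a.e.-vanishing functional is `0`. -/
theorem cyclicExpectation_eq_zero_of_ae (β : ℝ) (N m : ℕ) [NeZero N] [NeZero m]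
    {F : (ZMod m → GaugeConfig 3 N G) → ℝ}
    (hF : ∀ᵐ V ∂(Measure.pi fun _ : ZMod m => Measure.pi fun _ : Edge 3 N => haarProbability G), F V = 0) :
    cyclicExpectation ρ β N m F = 0 := by
  unfold cyclicExpectation
  rw [integral_eq_zero_of_ae, zero_div]
  filter_upwards [hF] with V hV
  simp only [hV, mul_zero, Pi.zero_apply]

/-- A cyclic expectation of a functional that is a.e. `1` is `1` (continuous unitary `ρ`, so that `Z > 0`). -/
theorem cyclicExpectation_eq_one_of_ae (hρ : Continuous ρ) (hρu : ∀ g, ρ g ∈ Matrix.unitaryGroup (Fin n) ℂ)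
    (β : ℝ) (N m : ℕ) [NeZero N] [NeZero m] {F : (ZMod m → GaugeConfig 3 N G) → ℝ}
    (hF : ∀ᵐ V ∂(Measure.pi fun _ : ZMod m => Measure.pi fun _ : Edge 3 N => haarProbability G), F V = 1) :
    cyclicExpectation ρ β N m F = 1 := by
  unfold cyclicExpectation
  have h1 : ∫ V : ZMod m → GaugeConfig 3 N G, (∏ t : ZMod m, wilsonSliceKernel ρ β (V t) (V (t + 1))) * F V
      ∂(Measure.pi fun _ : ZMod m => Measure.pi fun _ : Edge 3 N => haarProbability G) = cyclicPartition ρ β N m := by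
    unfold cyclicPartition
    refine integral_congr_ae ?_
    filter_upwards [hF] with V hV
    rw [hV, mul_one]
  rw [h1]
  exact div_self (cyclicPartition_pos_of_unitary ρ hρ hρu β N m).ne'

/-- **The rung on one torus, slice-chain currency.**  For continuous unitary `ρ`, `0 ≤ β ≤ strongCouplingRadius ρ`, a spatial torus
`(2S+1)³` and a measurable slice event `A`: `(1 − e^{−1/4})/2 · mass_m(A)(1 − mass_m(A)) ≤ mass_m(A) − stay_m(A)` for all large `m`. -/
theorem sliceConductance_eventually_of_strongCoupling (hρ : Continuous ρ) (hρu : ∀ g, ρ g ∈ Matrix.unitaryGroup (Fin n) ℂ)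
    {β : ℝ} (hβ0 : 0 ≤ β) (hβ : β ≤ strongCouplingRadius ρ) (S : ℕ)
    (Aset : Set (GaugeConfig 3 (2 * S + 1) G)) (hAset : MeasurableSet Aset) :
    ∃ m₀ : ℕ, ∀ m : ℕ, m₀ ≤ m →
      (1 - Real.exp (-(1 / 4))) / 2 *
          (sliceMass ρ β (2 * S + 1) (m + 2) Aset * (1 - sliceMass ρ β (2 * S + 1) (m + 2) Aset)) ≤
        sliceMass ρ β (2 * S + 1) (m + 2) Aset - sliceStay ρ β (2 * S + 1) (m + 2) Aset := by
  classical
  set μ : Measure (GaugeConfig 3 (2 * S + 1) G) := Measure.pi fun _ : Edge 3 (2 * S + 1) => haarProbability G with hμ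
  set K : GaugeConfig 3 (2 * S + 1) G → GaugeConfig 3 (2 * S + 1) G → ℝ := wilsonSliceKernel ρ β with hKdef
  set A := wilsonTorusTransferMatrix ρ β (2 * S + 1) with hAdef
  -- kernel facts
  have hK : StronglyMeasurable (uncurry K) := stronglyMeasurable_uncurry_wilsonSliceKernel ρ hρ β
  obtain ⟨C, hC⟩ := exists_norm_wilsonSliceKernel_le (L := (2 * S + 1)) ρ hρ β
  have hsymm : ∀ x y, K x y = K y x := wilsonSliceKernel_symm ρ hρu β
  have hpos : ∀ x y, 0 < K x y := wilsonSliceKernel_pos ρ hρ β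
  obtain ⟨κ₀, hκ₀, hKmin⟩ : ∃ κ₀ : ℝ, 0 < κ₀ ∧ ∀ U U' : GaugeConfig 3 (2 * S + 1) G, κ₀ ≤ K U U' := by
    have hcont := continuous_uncurry_wilsonSliceKernel (L := (2 * S + 1)) ρ hρ β
    obtain ⟨p, -, hp⟩ := isCompact_univ.exists_isMinOn univ_nonempty hcont.continuousOn
    exact ⟨K p.1 p.2, hpos p.1 p.2, fun U U' => (isMinOn_iff.mp hp) (U, U') (mem_univ _)⟩
  have hAker : ∀ φ : Lp ℝ 2 μ, (A φ : GaugeConfig 3 (2 * S + 1) G → ℝ) =ᵐ[μ] fun U => ∫ U', K U U' * φ U' ∂μ :=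
    wilsonTorusTransferMatrix_ae_eq β (2 * S + 1) hρ
  have hsa : IsSelfAdjoint A := isSelfAdjoint_wilsonTorusTransferMatrix (2 * S + 1) hρ hρu β
  have hcpt : IsCompactOperator A := isCompactOperator_wilsonTorusTransferMatrix β (2 * S + 1) hρ
  have himp : IsPositivityImproving A := isPositivityImproving_wilsonTorusTransferMatrix β (2 * S + 1) hρ
  have hA0 : A ≠ 0 := wilsonTorusTransferMatrix_ne_zero β (2 * S + 1) hρ
  -- spectral data (trace formula) and ground state
  obtain ⟨s, hs, b, lam, i₀, hb, hle, hL0, hi₀, hS2, hrad, hZ⟩ :=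
    exists_spectralData_wilsonTorusTransferMatrix (2 * S + 1) hρ hρu hβ0
  haveI : Countable s := hs
  have hlam0 : ∀ i, 0 ≤ lam i := fun i => (hle i).1
  obtain ⟨h, B, h₀, θ, hhm, hhB, hh₀, hlow, heig, hnorm, ⟨ε, hε2, hbε⟩, horth, hθ0, hθ, hgapl⟩ :=
    exists_groundState_data (μ := μ) hK hC hsymm hpos hκ₀ hKmin hAker hsa hcpt himp hA0 hb hlam0 hi₀
  set lam₀ : ℝ := lam i₀ with hlam₀def
  have hhpos : ∀ x, 0 < h x := fun x => hh₀.trans_le (hlow x)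
  -- (1) the limits `m → ∞` of the slice-chain probabilities (as in `traceExcess_le_of_sliceConductance`)
  set r : s → ℝ := fun i => lam i / lam₀ with hr
  have hr0 : ∀ i, 0 ≤ r i := fun i => div_nonneg (hlam0 i) hL0.le
  have hri₀ : r i₀ = 1 := div_self hL0.ne'
  set ϑ : ℝ := θ / lam₀ with hϑ
  have hϑ1 : ϑ < 1 := (div_lt_one hL0).2 hθ
  have hrϑ : ∀ i, i ≠ i₀ → r i ≤ ϑ := fun i hi => div_le_div_of_nonneg_right (hgapl i hi) hL0.le
  have hrsum : Summable fun i => r i ^ 2 := by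
    have := hS2.div_const (lam₀ ^ 2)
    refine this.congr fun i => ?_
    rw [hr]; simp only; rw [div_pow]
  set f : GaugeConfig 3 (2 * S + 1) G → ℝ := Aset.indicator (fun _ => (1 : ℝ)) with hf
  have hfm : Measurable f := measurable_const.indicator hAset
  have hf01 : ∀ x, f x = 0 ∨ f x = 1 := fun x => by
    by_cases hx : x ∈ Aset
    · right; simp [hf, hx]
    · left; simp [hf, hx]
  have hfb : ∀ x, ‖f x‖ ≤ 1 := fun x => by rcases hf01 x with h0 | h0 <;> simp [h0]
  have hone : ∀ x : GaugeConfig 3 (2 * S + 1) G, ‖(fun _ : GaugeConfig 3 (2 * S + 1) G => (1 : ℝ)) x‖ ≤ 1 := fun x => by simp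
  have hX1m := stronglyMeasurable_fgKernel hK hfm (measurable_const : Measurable fun _ : GaugeConfig 3 (2 * S + 1) G => (1 : ℝ))
  have hX1b := norm_fgKernel_le hC hfb hone
  obtain ⟨X1, hX1⟩ := exists_kernelOp (μ := μ) hX1m hX1b
  have hX2m := stronglyMeasurable_fgKernel hK hfm hfm
  have hX2b := norm_fgKernel_le hC hfb hfb
  obtain ⟨X2, hX2⟩ := exists_kernelOp (μ := μ) hX2m hX2b
  set πc : s → ℝ := fun i => ∫ x, f x * (b i x) ^ 2 ∂μ with hπc
  set qc : s → ℝ := fun i => ⟪b i, X2 (b i)⟫ with hqc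
  have hπb : ∀ i, |πc i| ≤ 1 := by
    intro i
    have hsq : Integrable (fun x => (b i x) ^ 2) μ := (Lp.memLp (b i)).integrable_sq
    have h1 : ∫ x, (b i x) ^ 2 ∂μ = 1 := by
      have := inner_eq_integral (μ := μ) (b i) (b i)
      rw [real_inner_self_eq_norm_sq, b.orthonormal.norm_eq_one i, one_pow] at this
      rw [this]; refine integral_congr_ae (Eventually.of_forall fun x => ?_); ring
    have hnn : 0 ≤ πc i := integral_nonneg fun x => by
      rcases hf01 x with h0 | h0 <;> simp [h0, sq_nonneg]
    have hle1 : πc i ≤ 1 := by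
      rw [← h1]
      refine integral_mono_of_nonneg (Eventually.of_forall fun x => ?_) hsq (Eventually.of_forall fun x => ?_)
      · rcases hf01 x with h0 | h0 <;> simp [h0, sq_nonneg]
      · rcases hf01 x with h0 | h0 <;> simp [h0, sq_nonneg]
    rw [abs_of_nonneg hnn]; exact hle1
  have hqb : ∀ i, |qc i| ≤ ‖X2‖ := fun i => by
    calc |qc i| ≤ ‖b i‖ * ‖X2 (b i)‖ := abs_real_inner_le_norm _ _
      _ ≤ ‖b i‖ * (‖X2‖ * ‖b i‖) := mul_le_mul_of_nonneg_left (X2.le_opNorm _) (norm_nonneg _)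
      _ = ‖X2‖ := by rw [b.orthonormal.norm_eq_one i]; ring
  have hlamr : ∀ i, lam i = lam₀ * r i := fun i => by rw [hr]; simp only; rw [mul_div_cancel₀ _ hL0.ne']
  have hmass : ∀ M : ℕ, sliceMass ρ β (2 * S + 1) (M + 1 + 2) Aset =
      (∑' i, r i ^ (M + 1 + 2) * πc i) / (∑' i, r i ^ (M + 1 + 2)) := by
    intro M
    have hS := hasSum_cyclic_insert_fg (μ := μ) hK hC hsymm hAker hb hfm
      (measurable_const : Measurable fun _ : GaugeConfig 3 (2 * S + 1) G => (1 : ℝ)) hfb hone hX1 M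
    have hcoef : ∀ i, lam i ^ (M + 2) * ⟪b i, X1 (b i)⟫ = lam i ^ (M + 1 + 2) * πc i := by
      intro i
      rw [inner_fgOp_one_eq (μ := μ) hAker hb hX1 i]
      ring
    simp_rw [hcoef, mul_one] at hS
    unfold sliceMass
    rw [cyclicExpectation_eq]
    exact ratio_eq_of_hasSum hL0.ne' hlamr (M + 1 + 2) hS (hZ (M + 1))
  have hstay : ∀ M : ℕ, sliceStay ρ β (2 * S + 1) (M + 1 + 2) Aset =
      lam₀⁻¹ * ((∑' i, r i ^ (M + 2) * qc i) / (∑' i, r i ^ (M + 2 + 1))) := by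
    intro M
    have hS := hasSum_cyclic_insert_fg (μ := μ) hK hC hsymm hAker hb hfm hfm hfb hfb hX2 M
    unfold sliceStay
    rw [cyclicExpectation_eq]
    exact ratio_eq_of_hasSum_succ hL0.ne' hlamr (M + 2) hS (hZ (M + 1))
  have hTπ : Tendsto (fun M : ℕ => ∑' i, r i ^ (M + 1 + 2) * πc i) atTop (𝓝 (πc i₀)) :=
    (tendsto_tsum_pow_mul hr0 hri₀ hϑ1 hrϑ hrsum hπb).comp (tendsto_add_atTop_nat 1)
  have hT1 : Tendsto (fun M : ℕ => ∑' i, r i ^ (M + 1 + 2)) atTop (𝓝 1) := by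
    have h1 := (tendsto_tsum_pow_mul (c := fun _ => (1 : ℝ)) (B := 1) hr0 hri₀ hϑ1 hrϑ hrsum
      (fun _ => by simp)).comp (tendsto_add_atTop_nat 1)
    refine h1.congr fun M => ?_
    simp only [Function.comp_apply, mul_one]
  have hT1' : Tendsto (fun M : ℕ => ∑' i, r i ^ (M + 2 + 1)) atTop (𝓝 1) := hT1
  have hTq : Tendsto (fun M : ℕ => ∑' i, r i ^ (M + 2) * qc i) atTop (𝓝 (qc i₀)) :=
    tendsto_tsum_pow_mul hr0 hri₀ hϑ1 hrϑ hrsum hqb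
  have hTmass : Tendsto (fun M : ℕ => sliceMass ρ β (2 * S + 1) (M + 1 + 2) Aset) atTop (𝓝 (πc i₀)) := by
    have := hTπ.div hT1 one_ne_zero
    rw [div_one] at this
    exact this.congr fun M => (hmass M).symm
  have hTstay : Tendsto (fun M : ℕ => sliceStay ρ β (2 * S + 1) (M + 1 + 2) Aset) atTop (𝓝 (lam₀⁻¹ * qc i₀)) := by
    have := (hTq.div hT1' one_ne_zero).const_mul lam₀⁻¹
    rw [div_one] at this
    exact this.congr fun M => (hstay M).symm
  -- identification of the limits with the ground state
  have hπ₀ : πc i₀ = ∫ x in Aset, h x ^ 2 ∂μ := by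
    have h1 : πc i₀ = ∫ x, f x * h x ^ 2 ∂μ := by
      refine integral_congr_ae ?_
      filter_upwards [hbε] with x hx
      rw [hx, mul_pow, hε2, one_mul]
    rw [h1, ← integral_indicator hAset]
    refine integral_congr_ae (Eventually.of_forall fun x => ?_)
    rcases hf01 x with h0 | h0
    · have hx : x ∉ Aset := by
        intro hx; simp [hf, hx] at h0
      simp [h0, hx]
    · have hx : x ∈ Aset := by
        by_contra hx; simp [hf, hx] at h0
      simp [h0, hx]
  have hq₀ : qc i₀ = ∫ x in Aset, ∫ y in Aset, h x * K x y * h y ∂μ ∂μ := by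
    have h1 : qc i₀ = ∫ x, f x * b i₀ x * ∫ y, K x y * (f y * b i₀ y) ∂μ ∂μ := inner_fgOp_eq (μ := μ) hX2 i₀
    have h2 : ∀ x, ∫ y, K x y * (f y * b i₀ y) ∂μ = ∫ y, K x y * (f y * (ε * h y)) ∂μ := fun x =>
      integral_congr_ae (by filter_upwards [hbε] with y hy; rw [hy])
    rw [h1]
    simp_rw [h2]
    have h3 : ∫ x, f x * b i₀ x * ∫ y, K x y * (f y * (ε * h y)) ∂μ ∂μ =
        ∫ x, f x * (ε * h x) * ∫ y, K x y * (f y * (ε * h y)) ∂μ ∂μ :=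
      integral_congr_ae (by filter_upwards [hbε] with x hx; rw [hx])
    rw [h3, ← integral_indicator hAset]
    refine integral_congr_ae (Eventually.of_forall fun x => ?_)
    have hin : ∫ y, K x y * (f y * (ε * h y)) ∂μ = ε * ∫ y in Aset, K x y * h y ∂μ := by
      rw [← integral_indicator hAset, ← integral_const_mul]
      refine integral_congr_ae (Eventually.of_forall fun y => ?_)
      by_cases hy : y ∈ Aset
      · simp [hf, hy]; ring
      · simp [hf, hy]
    dsimp only
    rw [hin]
    by_cases hx : x ∈ Aset
    · simp only [hf, hx, Set.indicator_of_mem, one_mul]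
      have : ε * h x * (ε * ∫ y in Aset, K x y * h y ∂μ) = ε ^ 2 * (h x * ∫ y in Aset, K x y * h y ∂μ) := by ring
      rw [this, hε2, one_mul, ← integral_const_mul]
      refine integral_congr_ae (Eventually.of_forall fun y => ?_); ring
    · simp [hf, hx]
  -- the strong-coupling eigenbasis and its volume-uniform gap; its top vector is `±h`
  obtain ⟨s', hs', b', lam', i₀', hb', hle', hL0', hrad', hgap'⟩ := transferGap_of_strongCoupling (L := (2 * S + 1)) ρ hρ hρu hβ0 hβ
  have hl' : lam' i₀' = lam₀ := by rw [← hrad', hrad]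
  have hgap'' : ∀ i, i ≠ i₀' → lam' i ≤ Real.exp (-(1 / 4)) * lam₀ := fun i hi => hl' ▸ hgap' i hi
  obtain ⟨φ, hφ1, -, -, hsimple, -⟩ := himp.exists_spectralGap hsa hcpt hA0
  have hbφ : b i₀ = ⟪φ, b i₀⟫ • φ := hsimple (b i₀) (by rw [hb i₀, ← hlam₀def, hi₀])
  have hbφ' : b' i₀' = ⟪φ, b' i₀'⟫ • φ := hsimple (b' i₀') (by rw [hb' i₀', hl', hi₀])
  obtain ⟨a₁, ha₁⟩ : ∃ a₁ : ℝ, a₁ = ⟪φ, b i₀⟫ := ⟨_, rfl⟩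
  obtain ⟨a₂, ha₂⟩ : ∃ a₂ : ℝ, a₂ = ⟪φ, b' i₀'⟫ := ⟨_, rfl⟩
  rw [← ha₁] at hbφ
  rw [← ha₂] at hbφ'
  have ha₁sq : a₁ ^ 2 = 1 := by
    have h1 : ‖b i₀‖ = |a₁| * ‖φ‖ := by conv_lhs => rw [hbφ]; rw [norm_smul, Real.norm_eq_abs]
    rw [b.orthonormal.norm_eq_one i₀, hφ1, mul_one] at h1; rw [← sq_abs, ← h1, one_pow]
  have ha₂sq : a₂ ^ 2 = 1 := by
    have h1 : ‖b' i₀'‖ = |a₂| * ‖φ‖ := by conv_lhs => rw [hbφ']; rw [norm_smul, Real.norm_eq_abs]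
    rw [b'.orthonormal.norm_eq_one i₀', hφ1, mul_one] at h1; rw [← sq_abs, ← h1, one_pow]
  have hb'b : b' i₀' = (a₂ * a₁) • b i₀ := by
    rw [hbφ, smul_smul, mul_assoc, ← sq, ha₁sq, mul_one, ← hbφ']
  have hε'2 : (a₂ * a₁ * ε) ^ 2 = 1 := by rw [mul_pow, mul_pow, ha₁sq, ha₂sq, hε2]; ring
  have hbε' : (b' i₀' : GaugeConfig 3 (2 * S + 1) G → ℝ) =ᵐ[μ] fun x => (a₂ * a₁ * ε) * h x := by
    rw [hb'b]
    filter_upwards [Lp.coeFn_smul (a₂ * a₁) (b i₀), hbε] with x hx hx'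
    rw [hx, Pi.smul_apply, smul_eq_mul, hx']; ring
  -- (2) the vacuum conductance `(1 − e^{-1/4}) P (1 − P) ≤ P − λ₀⁻¹ ∫_A∫_A hKh`
  have hvar := setIntegral_kernel_le_of_gap (μ := μ) hAker hsa hb' (i₀ := i₀') (lam1 := Real.exp (-(1 / 4)) * lam₀)
    hgap'' hhm hhB hε'2 hbε' hAset
  rw [hl'] at hvar
  have hcond0 : (1 - Real.exp (-(1 / 4))) * (∫ x in Aset, h x ^ 2 ∂μ) * (1 - ∫ x in Aset, h x ^ 2 ∂μ) ≤
      (∫ x in Aset, h x ^ 2 ∂μ) - lam₀⁻¹ * ∫ x in Aset, ∫ y in Aset, h x * K x y * h y ∂μ ∂μ :=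
    conductance_arith (inv_mul_gap_arith hL0 hvar)
  -- the limit quantities `P`, `Q`
  obtain ⟨P, hPdef⟩ : ∃ P : ℝ, P = ∫ x in Aset, h x ^ 2 ∂μ := ⟨_, rfl⟩
  rw [hπ₀, ← hPdef] at hTmass
  rw [hq₀] at hTstay
  rw [← hPdef] at hcond0
  -- `h² ≥ h₀² > 0`: a set of vanishing `∫ h²` is Haar-null
  have hh2m : Measurable fun x => h x ^ 2 := hhm.pow_const 2
  have hh2b : ∀ x, ‖h x ^ 2‖ ≤ B ^ 2 := fun x => by
    rw [Real.norm_eq_abs, abs_of_nonneg (sq_nonneg _)]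
    have := hhB x
    rw [Real.norm_eq_abs] at this
    calc h x ^ 2 = |h x| ^ 2 := (sq_abs _).symm
      _ ≤ B ^ 2 := pow_le_pow_left₀ (abs_nonneg _) this 2
  have hh2i : Integrable (fun x => h x ^ 2) μ := integrable_of_bdd hh2m hh2b
  have hnull : ∀ E : Set (GaugeConfig 3 (2 * S + 1) G), MeasurableSet E → ∫ x in E, h x ^ 2 ∂μ = 0 → μ E = 0 := by
    intro E hE hI
    have h1 : ∫ x in E, h₀ ^ 2 ∂μ ≤ ∫ x in E, h x ^ 2 ∂μ :=
      setIntegral_mono_on (integrable_const _).integrableOn hh2i.integrableOn hE fun x _ =>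
        pow_le_pow_left₀ hh₀.le (hlow x) 2
    rw [setIntegral_const, smul_eq_mul, hI] at h1
    have h2 : μ.real E ≤ 0 := by
      by_contra hcon
      exact absurd h1 (not_le.2 (mul_pos (lt_of_not_ge hcon) (pow_pos hh₀ 2)))
    exact (measureReal_eq_zero_iff (measure_ne_top μ E)).1 (le_antisymm h2 measureReal_nonneg)
  -- a.e. consequences on the slice chain
  have hP0 : 0 ≤ P := by rw [hPdef]; exact setIntegral_nonneg hAset fun x _ => sq_nonneg _
  have hP1 : P ≤ 1 := by
    have := hπb i₀
    rw [hπ₀, ← hPdef] at this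
    exact (le_abs_self _).trans this
  rcases hP0.eq_or_lt with hPz | hPpos
  · -- `P = 0`: `A` is null, `mass_m(A) = stay_m(A) = 0`
    have hA0' : μ Aset = 0 := hnull Aset hAset (by rw [← hPdef]; exact hPz.symm)
    refine ⟨0, fun m _ => ?_⟩
    have hae : ∀ᵐ V ∂(Measure.pi fun _ : ZMod (m + 2) => μ), V 0 ∉ Aset :=
      measure_eq_zero_iff_ae_notMem.1
        ((measurePreserving_eval (fun _ : ZMod (m + 2) => μ) 0).quasiMeasurePreserving.preimage_null hA0')
    have hm0 : sliceMass ρ β (2 * S + 1) (m + 2) Aset = 0 := by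
      unfold sliceMass
      refine cyclicExpectation_eq_zero_of_ae (ρ := ρ) β (2 * S + 1) (m + 2) ?_
      filter_upwards [hae] with V hV
      exact Set.indicator_of_notMem hV _
    have hs0 : sliceStay ρ β (2 * S + 1) (m + 2) Aset = 0 := by
      unfold sliceStay
      refine cyclicExpectation_eq_zero_of_ae (ρ := ρ) β (2 * S + 1) (m + 2) ?_
      filter_upwards [hae] with V hV
      rw [Set.indicator_of_notMem hV, zero_mul]
    rw [hm0, hs0]
    norm_num
  rcases hP1.eq_or_lt with hPo | hPlt
  · -- `P = 1`: `Aᶜ` is null, `mass_m(A) = stay_m(A) = 1`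
    have hAc : μ Asetᶜ = 0 := by
      refine hnull Asetᶜ hAset.compl ?_
      rw [setIntegral_compl hAset hh2i, hnorm, ← hPdef, hPo, sub_self]
    refine ⟨0, fun m _ => ?_⟩
    have hae0 : ∀ᵐ V ∂(Measure.pi fun _ : ZMod (m + 2) => μ), V 0 ∉ Asetᶜ :=
      measure_eq_zero_iff_ae_notMem.1
        ((measurePreserving_eval (fun _ : ZMod (m + 2) => μ) 0).quasiMeasurePreserving.preimage_null hAc)
    have hae1 : ∀ᵐ V ∂(Measure.pi fun _ : ZMod (m + 2) => μ), V 1 ∉ Asetᶜ :=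
      measure_eq_zero_iff_ae_notMem.1
        ((measurePreserving_eval (fun _ : ZMod (m + 2) => μ) 1).quasiMeasurePreserving.preimage_null hAc)
    have hm1 : sliceMass ρ β (2 * S + 1) (m + 2) Aset = 1 := by
      unfold sliceMass
      refine cyclicExpectation_eq_one_of_ae hρ hρu β (2 * S + 1) (m + 2) ?_
      filter_upwards [hae0] with V hV
      exact Set.indicator_of_mem (not_notMem.1 hV) _
    have hs1 : sliceStay ρ β (2 * S + 1) (m + 2) Aset = 1 := by
      unfold sliceStay
      refine cyclicExpectation_eq_one_of_ae hρ hρu β (2 * S + 1) (m + 2) ?_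
      filter_upwards [hae0, hae1] with V hV hV'
      rw [Set.indicator_of_mem (not_notMem.1 hV), Set.indicator_of_mem (not_notMem.1 hV'), mul_one]
    rw [hm1, hs1]
    norm_num
  -- main case `0 < P < 1`: the limit inequality is strict
  have hlt : (1 - Real.exp (-(1 / 4))) / 2 * (P * (1 - P)) <
      P - lam₀⁻¹ * ∫ x in Aset, ∫ y in Aset, h x * K x y * h y ∂μ ∂μ := by
    refine half_mul_lt_of_le ?_ (mul_pos hPpos (by linarith)) ?_
    · have : Real.exp (-(1 / 4 : ℝ)) < 1 := Real.exp_lt_one_iff.2 (by norm_num)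
      linarith
    · rw [← mul_assoc]; exact hcond0
  have hev := (((hTmass.mul (tendsto_const_nhds.sub hTmass)).const_mul ((1 - Real.exp (-(1 / 4))) / 2)).eventually_lt
    (hTmass.sub hTstay) hlt)
  obtain ⟨M₀, hM₀⟩ := eventually_atTop.1 hev
  refine ⟨M₀ + 1, fun m hm => ?_⟩
  obtain ⟨M, rfl⟩ : ∃ M, m = M + 1 := ⟨m - 1, by omega⟩
  exact (hM₀ M (by omega)).le

end PerTorus

/-- **The strong-coupling rung PROVED** (slice-chain currency, the registered `stub_rungStrongCoupling` of skeleton v5): for every compact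
`G` with a lattice representation `r` there are `c = (1 − e^{−1/4})/2 > 0` and `β₀ = strongCouplingRadius r.ρ > 0` such that for
`0 ≤ β ≤ β₀`, every spatial torus and every measurable slice event, `c · mass(1 − mass) ≤ mass − stay` eventually in the temporal extent. -/
theorem sliceConductanceStrongCoupling_holds :
    ∀ (G : Type) [Group G] [TopologicalSpace G] [IsTopologicalGroup G] [CompactSpace G]
      [MeasurableSpace G] [BorelSpace G] (r : LatticeRep G), SliceConductanceStrongCoupling G r := by
  intro G _ _ _ _ _ _ r
  haveI : SecondCountableTopology G :=
    (r.continuous.isClosedEmbedding r.injective).isEmbedding.secondCountableTopology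
  refine ⟨(1 - Real.exp (-(1 / 4))) / 2, strongCouplingRadius r.ρ, ?_, strongCouplingRadius_pos r.ρ,
    fun β hβ0 hβ S Aset hAset => ?_⟩
  · have : Real.exp (-(1 / 4 : ℝ)) < 1 := Real.exp_lt_one_iff.2 (by norm_num)
    linarith
  · exact sliceConductance_eventually_of_strongCoupling r.continuous r.mem_unitary hβ0 hβ S Aset hAset

end Summit.QuantumFields.YangMills.Cruxes.IR.VacuumEscape

end
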